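import Summits.Ventures.QEC.Census.Kernel.TB_l3m12_A0_0_0_1_0_2_1_8_B0_0_0_1_0_4_1_4.Distance
import Summits.Ventures.QEC.Census.Kernel.TB_l3m18_A0_0_1_7_2_2_B0_0_1_9_2_3.Distance
import Summits.Ventures.QEC.Census.BB.BBRows
import Summits.Ventures.QEC.Census.BB.Claims
import Literature.InformationTheory.QuantumCodes.TwoBlockConnectedComponents
import Literature.InformationTheory.QuantumCodes.TwoBlockToricLayout
import Literature.InformationTheory.QuantumCodes.TwoBlockWheelComponents
import Literature.InformationTheory.QuantumCodes.TwoBlockRootParameters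
import HarnessLib
import HarnessLib.Audit.Tags

/-!
# Census rows as TYPED two-block codes `QC(A, B)` on `ℤ_ℓ × ℤ_m` — bridge batch `KernelRowsQC04` (2 row(s), kernel tier)

Family: abelian two-block over ℤ_ℓ × ℤ_m (qec census one-module KERNEL-std rows: qec-search-7 certificate modules, MITM and
Brouwer–Zimmermann/automorphism formats). For each census row below (an EXPLICIT matrix code
`cert.code _ = CSSCode.ofMatrices (rowMatrix n cert.HX) (rowMatrix n cert.HZ)` with `IsCode n k d` certified in its own module), this file
puts the row's CONSTRUCTION into the kernel statement, as in the pilot `Census/BB/A1s_n144_k32_4addf704QC.lean` (p511732) and the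
gen-4 batches `A1sRowsQC1–5` / `TwoBGARowsQC1–4`: monomial lists `la`, `lb` (from the certificate's construction record — the
docstring's `A_terms`/`B_terms` or the census row id `2bga-lℓmm-A…-B…`, monomials `xⁱyʲ` as `[i,j]`, convention of BCGMRY24 §4 =
`BivariateBicycleCodes.lean`; the index identity was ALSO re-verified row-for-row by the emitter before filing), the typed object
`qc : BB.Code ℓ m := ⟨polyL la, polyL lb⟩`, the kernel INDEX IDENTITIES `cert.HX = BBRows.rowsX la lb`, `cert.HZ = BBRows.rowsZ la lb`
(`decide`; verified row generator `Census/BB/BBRows.lean`, p502918), the flat identities via `BBRows.rowMatrix_rowsX/Z`, the transport of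
the row's own `dZ_eq` and `k` (its `k_eq`, or the `k`-component of its `isCode`) by type-05's `BB.Code.dZ_eq_of_flat` / `k_eq_of_flat` to
`qc_hasParams : BB.HasParams qc n k d` (census predicate of family BB, `Census/BB/Claims.lean`, distance EXACT) and
`qc_isCode : qc.css.IsCode n k d`; and the census LAYOUT columns (Bravyi et al. 2024 §4 — arXiv:2308.07915: Lemma 2 p0010 L49, Lemma 3 p0011 L9, Lemma 4 p0011 L28; locators per qec-ref-2 2026-08-27T10:27Z) as KERNEL verdicts: «connected» —
`qc_tannerGraph_connected` (Lemma 3, `BB.Code.tannerGraph_connected_of_unit_mem`, explicit multiples of exponent differences) or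
`qc_tannerGraph_not_connected` + `card_expDiffSubgroup` + `qc_card_connectedComponent` (`⟨S⟩` = an explicit finite carrier `diffList`,
both inclusions certified; exact component count by Lemma 3 (ii), `BB.Code.card_connectedComponent_mul_card`; by the tree's connected
normal form `TwoBlockConnectedComponents.lean` such a code is the disjoint union of that many copies of its root code, whose parameters
`[[n/c, k/c, d]]` and connectedness are certified here as `root_isCode` via `TwoBlockRootParameters.lean`); «toric layout» —
`qc_hasToricLayoutWith μ λ` (Lemma 4, `BB.Code.hasToricLayoutWith_of_exponents`; omitted when its sufficient condition has no witness);
«wheel layers» — `qc_wheel_layers` (Lemma 2 minus planarity, `BB.Code.exists_wheel_layers`, weight-(3,3) rows only):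

* `TB_l3m12_A0_0_0_1_0_2_1_8_B0_0_0_1_0_4_1_4` = `QC(1 + y + y^2 + xy^8, 1 + y + y^4 + xy^4)` on `ℤ_3 × ℤ_12`: `[[72, 2, 12]]`; Tanner graph connected; toric layout (12,3)
* `TB_l3m18_A0_0_1_7_2_2_B0_0_1_9_2_3` = `QC(1 + xy^7 + x^2y^2, 1 + xy^9 + x^2y^3)` on `ℤ_3 × ℤ_18`: `[[108, 8, 10]]`; Tanner graph connected; toric layout (18,3); wheel layers 36/12

No new certificate — tier KERNEL, axioms standard, no `native_decide`. HONEST FRAMING: identifies already-certified census objects with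
named algebraic constructions and decides structural (graph) properties; the census comparator columns (printed values, optimality
words) are not touched; for disconnected rows the root code is identified abstractly over `↥⟨S⟩` (not re-indexed to a named `QC(A',B')`,
not identified with a smaller census row); planarity/thickness is not asserted. Generated by
qec-type-05 gen 6's `tools/emit_qc_bridge3.py` (gen 5's emitter + sibling-data rows + ℓ = 1 connectivity) + `tools/conn_cert.py` (HOME/lean/type-05/tools/).
-/

namespace Summit.Ventures.QEC.Census.TB_l3m12_A0_0_0_1_0_2_1_8_B0_0_0_1_0_4_1_4

open Matrix Literature.InformationTheory.QuantumCodes BBRows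

/-- Monomials of `A = 1 + y + y^2 + xy^8` (construction `A_terms = [[0, 0], [0, 1], [0, 2], [1, 8]]`, from the census row id `2bga-l3m12-A0-0.0-1.0-2.1-8-B0-0.0-1.0-4.1-4` named in the row module). DATA. -/
def la : List (BB.Mono 3 12) := [(Fin.ofNat 3 0, Fin.ofNat 12 0), (Fin.ofNat 3 0, Fin.ofNat 12 1), (Fin.ofNat 3 0, Fin.ofNat 12 2), (Fin.ofNat 3 1, Fin.ofNat 12 8)]

/-- Monomials of `B = 1 + y + y^4 + xy^4` (construction `B_terms = [[0, 0], [0, 1], [0, 4], [1, 4]]`). DATA. -/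
def lb : List (BB.Mono 3 12) := [(Fin.ofNat 3 0, Fin.ofNat 12 0), (Fin.ofNat 3 0, Fin.ofNat 12 1), (Fin.ofNat 3 0, Fin.ofNat 12 4), (Fin.ofNat 3 1, Fin.ofNat 12 4)]

/-- The census row's code as a TYPED two-block code `QC(1 + y + y^2 + xy^8, 1 + y + y^4 + xy^4)` on `ℤ_3 × ℤ_12` (`BB.Code 3 12`). (definition) -/
def qc : BB.Code 3 12 := ⟨polyL la, polyL lb⟩

set_option maxRecDepth 100000 in
/-- INDEX IDENTITY, `X` side, in the kernel: the certificate's `H^X` rows ARE the `X`-check words of `qc` (`decide +kernel`). -/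
theorem HX_eq_rowsX : TB_l3m12_A0_0_0_1_0_2_1_8_B0_0_0_1_0_4_1_4.cert.HX = rowsX la lb := by
  decide +kernel

set_option maxRecDepth 100000 in
/-- INDEX IDENTITY, `Z` side. -/
theorem HZ_eq_rowsZ : TB_l3m12_A0_0_0_1_0_2_1_8_B0_0_0_1_0_4_1_4.cert.HZ = rowsZ la lb := by
  decide +kernel

set_option maxRecDepth 100000 in
/-- The certificate's flat `H^X` is `qc.HXFlat`. -/
theorem rowMatrix_HX_eq : rowMatrix 72 TB_l3m12_A0_0_0_1_0_2_1_8_B0_0_0_1_0_4_1_4.cert.HX = qc.HXFlat := by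
  have cast : ∀ {H H' : List ℕ} (e : H = H'),
      rowMatrix 72 H = (rowMatrix 72 H').submatrix (Fin.cast (congrArg List.length e)) id := by
    intro H H' e; subst e; rfl
  exact (cast HX_eq_rowsX).trans (rowMatrix_rowsX qc (LA := la) (LB := lb) rfl rfl)

set_option maxRecDepth 100000 in
/-- The certificate's flat `H^Z` is `qc.HZFlat`. -/
theorem rowMatrix_HZ_eq : rowMatrix 72 TB_l3m12_A0_0_0_1_0_2_1_8_B0_0_0_1_0_4_1_4.cert.HZ = qc.HZFlat := by
  have cast : ∀ {H H' : List ℕ} (e : H = H'),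
      rowMatrix 72 H = (rowMatrix 72 H').submatrix (Fin.cast (congrArg List.length e)) id := by
    intro H H' e; subst e; rfl
  exact (cast HZ_eq_rowsZ).trans (rowMatrix_rowsZ qc (LA := la) (LB := lb) rfl rfl)

set_option maxRecDepth 100000 in
/-- `d^Z (qc) = 12`, transported from the census certificate (`TB_l3m12_A0_0_0_1_0_2_1_8_B0_0_0_1_0_4_1_4.dZ_eq`) by `BB.Code.dZ_eq_of_flat`. -/
theorem qc_dZ : qc.css.dZ = 12 :=
  (qc.dZ_eq_of_flat (D := TB_l3m12_A0_0_0_1_0_2_1_8_B0_0_0_1_0_4_1_4.cert.code (TB_l3m12_A0_0_0_1_0_2_1_8_B0_0_0_1_0_4_1_4.cert.commOK_of_checkStructure TB_l3m12_A0_0_0_1_0_2_1_8_B0_0_0_1_0_4_1_4.checkStructure_ok))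
    rowMatrix_HX_eq rowMatrix_HZ_eq).symm.trans TB_l3m12_A0_0_0_1_0_2_1_8_B0_0_0_1_0_4_1_4.dZ_eq

set_option maxRecDepth 100000 in
/-- `k (qc) = 2`, transported from the census certificate (the `k`-component of `TB_l3m12_A0_0_0_1_0_2_1_8_B0_0_0_1_0_4_1_4.isCode`) by `BB.Code.k_eq_of_flat`. -/
theorem qc_k : qc.k = 2 :=
  (qc.k_eq_of_flat (D := TB_l3m12_A0_0_0_1_0_2_1_8_B0_0_0_1_0_4_1_4.cert.code (TB_l3m12_A0_0_0_1_0_2_1_8_B0_0_0_1_0_4_1_4.cert.commOK_of_checkStructure TB_l3m12_A0_0_0_1_0_2_1_8_B0_0_0_1_0_4_1_4.checkStructure_ok))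
    rowMatrix_HX_eq rowMatrix_HZ_eq).symm.trans TB_l3m12_A0_0_0_1_0_2_1_8_B0_0_0_1_0_4_1_4.isCode.2.1

/-- **`QC(1 + y + y^2 + xy^8, 1 + y + y^4 + xy^4)` on `ℤ_3 × ℤ_12` has parameters `[[72, 2, 12]]`** (distance exact; `BB.HasParams`) — the census row
`TB_l3m12_A0_0_0_1_0_2_1_8_B0_0_0_1_0_4_1_4` read as a statement about the construction. KERNEL. -/
theorem qc_hasParams : Summit.Ventures.QEC.BB.HasParams qc 72 2 12 :=
  BB.hasParams_of_dZ (by simp only [BB.numQubits_eq]) qc_k qc_dZ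

/-- The same in the generic census vocabulary: `qc.css.IsCode 72 2 12`. -/
theorem qc_isCode : qc.css.IsCode 72 2 12 :=
  (BB.hasParams_iff_isCode (by decide)).1 qc_hasParams

set_option maxRecDepth 100000 in
/-- **The Tanner graph of `qc` is connected** (Bravyi et al. 2024 Lemma 3 / `BB.Code.tannerGraph_connected_of_unit_mem`): `x = (1,0)`
and `y = (0,1)` are explicit combinations of exponent differences inside `A` or inside `B` (found by qec-type-05's tools/conn_cert.py,
re-checked by `decide`). Census column «connected» for this row, KERNEL. -/
theorem qc_tannerGraph_connected : qc.css.tannerGraph.Connected := by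
  refine qc.tannerGraph_connected_of_unit_mem (fun h => absurd (congrFun h ((0 : Fin 3), (0 : Fin 12))) (by decide))
    (fun h => absurd (congrFun h ((0 : Fin 3), (0 : Fin 12))) (by decide)) ?_ ?_
  · have e : (((1 : Fin 3), (0 : Fin 12)) : BB.Mono 3 12) = (2 : ℕ) • ((((0 : Fin 3), (2 : Fin 12))) - (1, 8)) := by decide
    rw [e]
    exact (AddSubgroup.nsmul_mem _ (qc.sub_mem_expDiffSubgroup_A (by decide) (by decide)) 2)
  · have e : (((0 : Fin 3), (1 : Fin 12)) : BB.Mono 3 12) = (11 : ℕ) • ((((0 : Fin 3), (0 : Fin 12))) - (0, 1)) := by decide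
    rw [e]
    exact (AddSubgroup.nsmul_mem _ (qc.sub_mem_expDiffSubgroup_A (by decide) (by decide)) 11)

set_option maxRecDepth 100000 in
/-- **`qc` has a toric layout with `(μ, λ) = (12, 3)`** (Bravyi et al. 2024 Lemma 4 / `BB.Code.hasToricLayoutWith_of_exponents`): the two layout
generators `A_iA_jᵀ ↦ (0, 0) − (0, 1)` and `B_gB_hᵀ ↦ (0, 0) − (1, 4)` generate `ℤ_3 × ℤ_12` generate the group
(explicit multiples giving `x` and `y`) and have orders `12` and `3` (product `36 = ℓm`). — both facts `decide`d as LOCAL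
steps (they mention no row constant, so as separate theorems they would restate the same statement across rows). Census
layout column, KERNEL. -/
theorem qc_hasToricLayoutWith : HasToricLayoutWith 12 3 qc.css.tannerGraph := by
  have hgen : AddSubgroup.closure ({((0 : Fin 3), (0 : Fin 12)) - (0, 1), ((0 : Fin 3), (0 : Fin 12)) - (1, 4)} : Set (BB.Mono 3 12)) = ⊤ := by
    apply BB.Code.addSubgroup_eq_top_of_unit_mem
    · have h1 := AddSubgroup.subset_closure (k := ({((0 : Fin 3), (0 : Fin 12)) - (0, 1), ((0 : Fin 3), (0 : Fin 12)) - (1, 4)} : Set (BB.Mono 3 12))) (Set.mem_insert _ _)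
      have h2 := AddSubgroup.subset_closure (k := ({((0 : Fin 3), (0 : Fin 12)) - (0, 1), ((0 : Fin 3), (0 : Fin 12)) - (1, 4)} : Set (BB.Mono 3 12))) (Set.mem_insert_of_mem _ rfl)
      have e : (4 : ℕ) • (((0 : Fin 3), (0 : Fin 12)) - (0, 1)) + (2 : ℕ) • (((0 : Fin 3), (0 : Fin 12)) - (1, 4)) = (1, 0) := by decide
      have h' := AddSubgroup.add_mem _ (AddSubgroup.nsmul_mem _ h1 4) (AddSubgroup.nsmul_mem _ h2 2)
      rw [e] at h'
      exact h'
    · have h1 := AddSubgroup.subset_closure (k := ({((0 : Fin 3), (0 : Fin 12)) - (0, 1), ((0 : Fin 3), (0 : Fin 12)) - (1, 4)} : Set (BB.Mono 3 12))) (Set.mem_insert _ _)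
      have h2 := AddSubgroup.subset_closure (k := ({((0 : Fin 3), (0 : Fin 12)) - (0, 1), ((0 : Fin 3), (0 : Fin 12)) - (1, 4)} : Set (BB.Mono 3 12))) (Set.mem_insert_of_mem _ rfl)
      have e : (11 : ℕ) • (((0 : Fin 3), (0 : Fin 12)) - (0, 1)) + (0 : ℕ) • (((0 : Fin 3), (0 : Fin 12)) - (1, 4)) = (0, 1) := by decide
      have h' := AddSubgroup.add_mem _ (AddSubgroup.nsmul_mem _ h1 11) (AddSubgroup.nsmul_mem _ h2 0)
      rw [e] at h'
      exact h'
  have hord : addOrderOf (((0 : Fin 3), (0 : Fin 12)) - (0, 1)) = 12 ∧ addOrderOf (((0 : Fin 3), (0 : Fin 12)) - (1, 4)) = 3 :=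
    ⟨(addOrderOf_eq_iff (by norm_num)).mpr (by decide), (addOrderOf_eq_iff (by norm_num)).mpr (by decide)⟩
  have h := qc.hasToricLayoutWith_of_exponents (g := ((0 : Fin 3), (0 : Fin 12))) (g' := (0, 1))
    (h := ((0 : Fin 3), (0 : Fin 12))) (h' := (1, 4)) (by decide) (by decide) (by decide) (by decide)
    hgen (by rw [hord.1, hord.2])
  rwa [hord.1, hord.2] at h

/-- `qc` has a toric layout. KERNEL. -/
theorem qc_hasToricLayout : HasToricLayout qc.css.tannerGraph :=
  ⟨12, 3, by norm_num, by norm_num, qc_hasToricLayoutWith⟩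

end Summit.Ventures.QEC.Census.TB_l3m12_A0_0_0_1_0_2_1_8_B0_0_0_1_0_4_1_4

namespace Summit.Ventures.QEC.Census.TB_l3m18_A0_0_1_7_2_2_B0_0_1_9_2_3

open Matrix Literature.InformationTheory.QuantumCodes BBRows

/-- Monomials of `A = 1 + xy^7 + x^2y^2` (construction `A_terms = [[0, 0], [1, 7], [2, 2]]`, from the census row id `2bga-l3m18-A0-0.1-7.2-2-B0-0.1-9.2-3` named in the row module). DATA. -/
def la : List (BB.Mono 3 18) := [(Fin.ofNat 3 0, Fin.ofNat 18 0), (Fin.ofNat 3 1, Fin.ofNat 18 7), (Fin.ofNat 3 2, Fin.ofNat 18 2)]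

/-- Monomials of `B = 1 + xy^9 + x^2y^3` (construction `B_terms = [[0, 0], [1, 9], [2, 3]]`). DATA. -/
def lb : List (BB.Mono 3 18) := [(Fin.ofNat 3 0, Fin.ofNat 18 0), (Fin.ofNat 3 1, Fin.ofNat 18 9), (Fin.ofNat 3 2, Fin.ofNat 18 3)]

/-- The census row's code as a TYPED two-block code `QC(1 + xy^7 + x^2y^2, 1 + xy^9 + x^2y^3)` on `ℤ_3 × ℤ_18` (`BB.Code 3 18`). (definition) -/
def qc : BB.Code 3 18 := ⟨polyL la, polyL lb⟩

set_option maxRecDepth 100000 in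
/-- INDEX IDENTITY, `X` side, in the kernel: the certificate's `H^X` rows ARE the `X`-check words of `qc` (`decide +kernel`). -/
theorem HX_eq_rowsX : TB_l3m18_A0_0_1_7_2_2_B0_0_1_9_2_3.cert.HX = rowsX la lb := by
  decide +kernel

set_option maxRecDepth 100000 in
/-- INDEX IDENTITY, `Z` side. -/
theorem HZ_eq_rowsZ : TB_l3m18_A0_0_1_7_2_2_B0_0_1_9_2_3.cert.HZ = rowsZ la lb := by
  decide +kernel

set_option maxRecDepth 100000 in
/-- The certificate's flat `H^X` is `qc.HXFlat`. -/
theorem rowMatrix_HX_eq : rowMatrix 108 TB_l3m18_A0_0_1_7_2_2_B0_0_1_9_2_3.cert.HX = qc.HXFlat := by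
  have cast : ∀ {H H' : List ℕ} (e : H = H'),
      rowMatrix 108 H = (rowMatrix 108 H').submatrix (Fin.cast (congrArg List.length e)) id := by
    intro H H' e; subst e; rfl
  exact (cast HX_eq_rowsX).trans (rowMatrix_rowsX qc (LA := la) (LB := lb) rfl rfl)

set_option maxRecDepth 100000 in
/-- The certificate's flat `H^Z` is `qc.HZFlat`. -/
theorem rowMatrix_HZ_eq : rowMatrix 108 TB_l3m18_A0_0_1_7_2_2_B0_0_1_9_2_3.cert.HZ = qc.HZFlat := by
  have cast : ∀ {H H' : List ℕ} (e : H = H'),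
      rowMatrix 108 H = (rowMatrix 108 H').submatrix (Fin.cast (congrArg List.length e)) id := by
    intro H H' e; subst e; rfl
  exact (cast HZ_eq_rowsZ).trans (rowMatrix_rowsZ qc (LA := la) (LB := lb) rfl rfl)

set_option maxRecDepth 100000 in
/-- `d^Z (qc) = 10`, transported from the census certificate (`TB_l3m18_A0_0_1_7_2_2_B0_0_1_9_2_3.dZ_eq`) by `BB.Code.dZ_eq_of_flat`. -/
theorem qc_dZ : qc.css.dZ = 10 :=
  (qc.dZ_eq_of_flat (D := TB_l3m18_A0_0_1_7_2_2_B0_0_1_9_2_3.cert.code (TB_l3m18_A0_0_1_7_2_2_B0_0_1_9_2_3.cert.commOK_of_checkStructure TB_l3m18_A0_0_1_7_2_2_B0_0_1_9_2_3.checkStructure_ok))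
    rowMatrix_HX_eq rowMatrix_HZ_eq).symm.trans TB_l3m18_A0_0_1_7_2_2_B0_0_1_9_2_3.dZ_eq

set_option maxRecDepth 100000 in
/-- `k (qc) = 8`, transported from the census certificate (the `k`-component of `TB_l3m18_A0_0_1_7_2_2_B0_0_1_9_2_3.isCode`) by `BB.Code.k_eq_of_flat`. -/
theorem qc_k : qc.k = 8 :=
  (qc.k_eq_of_flat (D := TB_l3m18_A0_0_1_7_2_2_B0_0_1_9_2_3.cert.code (TB_l3m18_A0_0_1_7_2_2_B0_0_1_9_2_3.cert.commOK_of_checkStructure TB_l3m18_A0_0_1_7_2_2_B0_0_1_9_2_3.checkStructure_ok))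
    rowMatrix_HX_eq rowMatrix_HZ_eq).symm.trans TB_l3m18_A0_0_1_7_2_2_B0_0_1_9_2_3.isCode.2.1

/-- **`QC(1 + xy^7 + x^2y^2, 1 + xy^9 + x^2y^3)` on `ℤ_3 × ℤ_18` has parameters `[[108, 8, 10]]`** (distance exact; `BB.HasParams`) — the census row
`TB_l3m18_A0_0_1_7_2_2_B0_0_1_9_2_3` read as a statement about the construction. KERNEL. -/
theorem qc_hasParams : Summit.Ventures.QEC.BB.HasParams qc 108 8 10 :=
  BB.hasParams_of_dZ (by simp only [BB.numQubits_eq]) qc_k qc_dZ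

/-- The same in the generic census vocabulary: `qc.css.IsCode 108 8 10`. -/
theorem qc_isCode : qc.css.IsCode 108 8 10 :=
  (BB.hasParams_iff_isCode (by decide)).1 qc_hasParams

set_option maxRecDepth 100000 in
/-- **The Tanner graph of `qc` is connected** (Bravyi et al. 2024 Lemma 3 / `BB.Code.tannerGraph_connected_of_unit_mem`): `x = (1,0)`
and `y = (0,1)` are explicit combinations of exponent differences inside `A` or inside `B` (found by qec-type-05's tools/conn_cert.py,
re-checked by `decide`). Census column «connected» for this row, KERNEL. -/
theorem qc_tannerGraph_connected : qc.css.tannerGraph.Connected := by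
  refine qc.tannerGraph_connected_of_unit_mem (fun h => absurd (congrFun h ((0 : Fin 3), (0 : Fin 18))) (by decide))
    (fun h => absurd (congrFun h ((0 : Fin 3), (0 : Fin 18))) (by decide)) ?_ ?_
  · have e : (((1 : Fin 3), (0 : Fin 18)) : BB.Mono 3 18) = (2 : ℕ) • ((((0 : Fin 3), (0 : Fin 18))) - (1, 9)) := by decide
    rw [e]
    exact (AddSubgroup.nsmul_mem _ (qc.sub_mem_expDiffSubgroup_B (by decide) (by decide)) 2)
  · have e : (((0 : Fin 3), (1 : Fin 18)) : BB.Mono 3 18) = (5 : ℕ) • ((((0 : Fin 3), (0 : Fin 18))) - (1, 7)) + (4 : ℕ) • ((((0 : Fin 3), (0 : Fin 18))) - (1, 9)) := by decide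
    rw [e]
    exact (AddSubgroup.add_mem _ (AddSubgroup.nsmul_mem _ (qc.sub_mem_expDiffSubgroup_A (by decide) (by decide)) 5) (AddSubgroup.nsmul_mem _ (qc.sub_mem_expDiffSubgroup_B (by decide) (by decide)) 4))

set_option maxRecDepth 100000 in
/-- **`qc` has a toric layout with `(μ, λ) = (18, 3)`** (Bravyi et al. 2024 Lemma 4 / `BB.Code.hasToricLayoutWith_of_exponents`): the two layout
generators `A_iA_jᵀ ↦ (0, 0) − (1, 7)` and `B_gB_hᵀ ↦ (1, 9) − (2, 3)` generate `ℤ_3 × ℤ_18` generate the group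
(explicit multiples giving `x` and `y`) and have orders `18` and `3` (product `54 = ℓm`). — both facts `decide`d as LOCAL
steps (they mention no row constant, so as separate theorems they would restate the same statement across rows). Census
layout column, KERNEL. -/
theorem qc_hasToricLayoutWith : HasToricLayoutWith 18 3 qc.css.tannerGraph := by
  have hgen : AddSubgroup.closure ({((0 : Fin 3), (0 : Fin 18)) - (1, 7), ((1 : Fin 3), (9 : Fin 18)) - (2, 3)} : Set (BB.Mono 3 18)) = ⊤ := by
    apply BB.Code.addSubgroup_eq_top_of_unit_mem
    · have h1 := AddSubgroup.subset_closure (k := ({((0 : Fin 3), (0 : Fin 18)) - (1, 7), ((1 : Fin 3), (9 : Fin 18)) - (2, 3)} : Set (BB.Mono 3 18))) (Set.mem_insert _ _)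
      have h2 := AddSubgroup.subset_closure (k := ({((0 : Fin 3), (0 : Fin 18)) - (1, 7), ((1 : Fin 3), (9 : Fin 18)) - (2, 3)} : Set (BB.Mono 3 18))) (Set.mem_insert_of_mem _ rfl)
      have e : (12 : ℕ) • (((0 : Fin 3), (0 : Fin 18)) - (1, 7)) + (2 : ℕ) • (((1 : Fin 3), (9 : Fin 18)) - (2, 3)) = (1, 0) := by decide
      have h' := AddSubgroup.add_mem _ (AddSubgroup.nsmul_mem _ h1 12) (AddSubgroup.nsmul_mem _ h2 2)
      rw [e] at h'
      exact h'
    · have h1 := AddSubgroup.subset_closure (k := ({((0 : Fin 3), (0 : Fin 18)) - (1, 7), ((1 : Fin 3), (9 : Fin 18)) - (2, 3)} : Set (BB.Mono 3 18))) (Set.mem_insert _ _)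
      have h2 := AddSubgroup.subset_closure (k := ({((0 : Fin 3), (0 : Fin 18)) - (1, 7), ((1 : Fin 3), (9 : Fin 18)) - (2, 3)} : Set (BB.Mono 3 18))) (Set.mem_insert_of_mem _ rfl)
      have e : (11 : ℕ) • (((0 : Fin 3), (0 : Fin 18)) - (1, 7)) + (1 : ℕ) • (((1 : Fin 3), (9 : Fin 18)) - (2, 3)) = (0, 1) := by decide
      have h' := AddSubgroup.add_mem _ (AddSubgroup.nsmul_mem _ h1 11) (AddSubgroup.nsmul_mem _ h2 1)
      rw [e] at h'
      exact h'
  have hord : addOrderOf (((0 : Fin 3), (0 : Fin 18)) - (1, 7)) = 18 ∧ addOrderOf (((1 : Fin 3), (9 : Fin 18)) - (2, 3)) = 3 :=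
    ⟨(addOrderOf_eq_iff (by norm_num)).mpr (by decide), (addOrderOf_eq_iff (by norm_num)).mpr (by decide)⟩
  have h := qc.hasToricLayoutWith_of_exponents (g := ((0 : Fin 3), (0 : Fin 18))) (g' := (1, 7))
    (h := ((1 : Fin 3), (9 : Fin 18))) (h' := (2, 3)) (by decide) (by decide) (by decide) (by decide)
    hgen (by rw [hord.1, hord.2])
  rwa [hord.1, hord.2] at h

/-- `qc` has a toric layout. KERNEL. -/
theorem qc_hasToricLayout : HasToricLayout qc.css.tannerGraph :=
  ⟨18, 3, by norm_num, by norm_num, qc_hasToricLayoutWith⟩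

set_option maxRecDepth 100000 in
/-- **`qc`**: Tanner graph = edge-disjoint union of two layers whose components are wheel graphs `prismGraph 36` (`A₃A₂ᵀ` of order
`18`) and `prismGraph 12` (`B₂B₁ᵀ` of order `6`) — BCGMRY24 Lemma 2 minus planarity (`BB.Code.exists_wheel_layers`). KERNEL. -/
theorem qc_wheel_layers :
    ∃ ΓA ΓB : SimpleGraph ((BB.Mono 3 18 ⊕ BB.Mono 3 18) ⊕ (BB.Mono 3 18 ⊕ BB.Mono 3 18)),
    qc.css.tannerGraph = ΓA ⊔ ΓB ∧ Disjoint ΓA ΓB ∧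
    (∀ K : ΓA.ConnectedComponent, Nonempty (K.toSimpleGraph ≃g prismGraph 36)) ∧
    (∀ K : ΓB.ConnectedComponent, Nonempty (K.toSimpleGraph ≃g prismGraph 12)) := by
  have hA : ∀ g : BB.Mono 3 18, qc.A g ≠ 0 ↔ g = ((0 : Fin 3), (0 : Fin 18)) ∨ g = ((1 : Fin 3), (7 : Fin 18)) ∨ g = ((2 : Fin 3), (2 : Fin 18)) := by decide +kernel
  have hB : ∀ g : BB.Mono 3 18, qc.B g ≠ 0 ↔ g = ((0 : Fin 3), (0 : Fin 18)) ∨ g = ((1 : Fin 3), (9 : Fin 18)) ∨ g = ((2 : Fin 3), (3 : Fin 18)) := by decide +kernel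
  have h := qc.exists_wheel_layers (g₁ := ((0 : Fin 3), (0 : Fin 18))) (g₂ := ((1 : Fin 3), (7 : Fin 18))) (g₃ := ((2 : Fin 3), (2 : Fin 18))) (h₁ := ((0 : Fin 3), (0 : Fin 18)))
    (h₂ := ((1 : Fin 3), (9 : Fin 18))) (h₃ := ((2 : Fin 3), (3 : Fin 18))) (by decide) (by decide) (by decide) (by decide) (by decide) (by decide) hA hB
  have e1 : addOrderOf (((2 : Fin 3), (2 : Fin 18)) - (1, 7)) = 18 := (addOrderOf_eq_iff (by norm_num)).mpr (by decide)
  have e2 : addOrderOf (((1 : Fin 3), (9 : Fin 18)) - (0, 0)) = 6 := (addOrderOf_eq_iff (by norm_num)).mpr (by decide)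
  rw [e1, e2] at h
  exact h

end Summit.Ventures.QEC.Census.TB_l3m18_A0_0_1_7_2_2_B0_0_1_9_2_3
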